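import Summits.NavierStokesRegularity.NavierStokesRegularity.Theorems.LerayQuarterDissipationFiniteDissipationLiouvilleFinalDatumProfile
import HarnessLib

/-!
# Crux `FiniteDissipationLiouville` (stmt-NavierStokesRegularity-22144): the FLICKER ENVELOPE —
# the unsteadiness of an enveloped Type-I profile decays like `√(−t)/(‖x‖+√(−t))`; for the
# critical element the flicker is confined to the parabolic core

Theorems file of route `LerayQuarterDissipation` (lead prover g14; `--supports` the crux; the upper
bound matching the dense-flicker floors of `…CalmSliceLocalLeaf` / `…CalmSliceMean` /
`…CalmVorticity`). Navier–Stokes regularity is NOT proved by anything here; no summit is. The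
UNSTEADINESS of `w` at `(t,x)`, `t < 0`, is `√(−t) • ((−t)∂ₜw − ½w − ½(x·∇)w)(t,x)` (`= ∂ₛU(y)`,
`y = x/√(−t)`).

* `unsteadiness_le_of_package` — for a Type-I ancient mild field with the space–time envelope
  `‖W(t,x)‖ ≤ A/(‖x‖+√(−t))` (`HasTypeIDecay A W`) and the scale-invariant package
  (`ScaleInvariantBounds W Q`: `‖∇W‖ ≤ L₁/(‖x‖+√(−t))²`, `‖∂ₜW‖ ≤ L₀/(‖x‖+√(−t))³`), the unsteadiness
  obeys `‖∂ₛU‖ ≤ (L₀ + (A + L₁)/2) · √(−t)/(‖x‖ + √(−t))`, i.e. `≤ c/(1+‖y‖)` in similarity variables.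
* `flickerEnvelope_of_minimal` — every critical element (singular member of `𝒟_{C,K_c}`, `K_c`
  minimal) carries such a bound: `…Envelope.envelope_of_minimal` + `…EnvelopePackage.scaleInvariantBounds_of_minimal`.

PORTRAIT (with the floors): the flicker of a finite-dissipation Type-I singularity is CONFINED TO THE
PARABOLIC CORE — dense with definite size `δ(C,K,ρ,r)` (pointwise, on average, and at the vorticity
level) in every sub-ball `B(x₀, r√(−t))`, `‖x₀‖ ≤ ρ√(−t)`, and `O(√(−t)/‖x‖)` beyond; in particular
`δ(C,K_c,ρ,r) ≤ c/(1 + ρ − r)`: the floors must degrade at spatial infinity (there the profile follows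
its own final datum, `∂ₛŨ₀ = −½ΛŨ₀ = O(1/‖y‖)`).

HONEST FRAMING: elementary consequence of the landed package; portrait only; nothing removed for
the DSS wall; the crux stays blocked on `∀ c > 1, TypeIDSSLiouville c` (NECESSARY, `…Hardness`).

References: Koch–Nadirashvili–Seregin–Šverák, arXiv:0709.3599 Prop. 4.1; Chae–Wolf,
arXiv:1610.09464 Thm 1.1; Pineau–Vicol, arXiv:2607.09619 §1.3.
-/

noncomputable section

-- the summit and its single sub-problem share the name (CONVENTIONS §1), as in every Theorems file
set_option linter.dupNamespace false

namespace Summit.NavierStokesRegularity.NavierStokesRegularity.Theorems.FiniteDissipationLiouville.CalmSliceLocal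

open MeasureTheory Set Filter Topology Metric Function TopologicalSpace InnerProductSpace
open Literature.Analysis Literature.Analysis.FluidPDE
open Summit.NavierStokesRegularity.NavierStokesRegularity.Theorems
open Summit.NavierStokesRegularity.NavierStokesRegularity.Theorems.FiniteDissipationLiouville
open Summit.NavierStokesRegularity.NavierStokesRegularity.Theorems.FiniteDissipationLiouville.FinalDatum
open scoped ENNReal NNReal RealInnerProductSpace

/-! ### The flicker envelope -/

/-- **The flicker envelope.** For a Type-I ancient mild field `W` with the space–time envelope
`HasTypeIDecay A W` and the scale-invariant package `ScaleInvariantBounds W Q`, there is `c ≥ 0` with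
`‖√(−t)((−t)∂ₜW − ½W − ½(x·∇)W)(t,x)‖ ≤ c · √(−t)/(‖x‖ + √(−t))` for all `t < 0`, `x`
(`c = L₀ + (A + L₁)/2` from the package constants of orders `0` and `1`): in similarity variables
`‖∂ₛU(y)‖ ≤ c/(1 + ‖y‖)`. [cite: KochNadirashviliSereginSverak2009, Prop. 4.1 (arXiv:0709.3599 p. 8)] -/
theorem unsteadiness_le_of_package {C A : ℝ}
    {W : ℝ → EuclideanSpace ℝ (Fin 3) → EuclideanSpace ℝ (Fin 3)} {Q : ℝ → EuclideanSpace ℝ (Fin 3) → ℝ}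
    (hW : IsTypeIAncientMild C W) (hA : HasTypeIDecay A W)
    (hS : RellichScarScarRigidity.ScaleInvariantBounds W Q) :
    ∃ c : ℝ, 0 ≤ c ∧ ∀ t : ℝ, t < 0 → ∀ x : EuclideanSpace ℝ (Fin 3),
      ‖Real.sqrt (-t) • ((-t) • deriv (fun τ => W τ x) t - (1 / 2 : ℝ) • W t x -
        (1 / 2 : ℝ) • fderiv ℝ (W t) x x)‖ ≤ c * (Real.sqrt (-t) / (‖x‖ + Real.sqrt (-t))) := by
  obtain ⟨L₀, hL₀⟩ := hS 0
  obtain ⟨L₁, hL₁⟩ := hS 1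
  have hL₀nn : 0 ≤ L₀ := by
    have h := (norm_nonneg _).trans (hL₀ (-1) (by norm_num) 0).1
    simpa using h
  have hL₁nn : 0 ≤ L₁ := by
    have h := (norm_nonneg _).trans (hL₁ (-1) (by norm_num) 0).1
    simpa using h
  have hAnn : 0 ≤ A := by
    have h := (norm_nonneg _).trans (hA (-1) (by norm_num) 0)
    simpa using h
  refine ⟨L₀ + (A + L₁) / 2, by positivity, fun t ht x => ?_⟩
  set μ : ℝ := Real.sqrt (-t) with hμ
  have hμpos : 0 < μ := Real.sqrt_pos.2 (neg_pos.2 ht)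
  have hμ2 : μ ^ 2 = -t := by rw [hμ, Real.sq_sqrt (neg_nonneg.2 ht.le)]
  set d : ℝ := ‖x‖ + μ with hd
  have hdpos : 0 < d := add_pos_of_nonneg_of_pos (norm_nonneg _) hμpos
  have hxd : ‖x‖ ≤ d := le_add_of_nonneg_right hμpos.le
  have hμd : μ ≤ d := le_add_of_nonneg_left (norm_nonneg _)
  -- the three package bounds at `(t, x)`
  have h0 : ‖W t x‖ ≤ A / d := hA t ht x
  have h1 : ‖fderiv ℝ (W t) x‖ ≤ L₁ / d ^ 2 := by
    have h := (hL₁ t ht x).1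
    rwa [norm_iteratedFDeriv_one] at h
  have h2 : ‖deriv (fun τ => W τ x) t‖ ≤ L₀ / d ^ 3 := by
    have e : (fun r => iteratedFDeriv ℝ 0 (W r) x) = fun r =>
        (continuousMultilinearCurryFin0 ℝ (EuclideanSpace ℝ (Fin 3)) (EuclideanSpace ℝ (Fin 3))).symm
          (W r x) := by
      funext r
      rfl
    have h3 := (hL₀ t ht x).2.2
    rwa [e, norm_deriv_linearIsometryEquiv_comp _ (differentiableAt_slice_and_fderiv hW x ht).1]
      at h3
  -- assemble
  have hxdx : ‖fderiv ℝ (W t) x x‖ ≤ L₁ / d ^ 2 * ‖x‖ :=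
    (ContinuousLinearMap.le_opNorm _ _).trans (mul_le_mul_of_nonneg_right h1 (norm_nonneg _))
  have hsum : ‖(-t) • deriv (fun τ => W τ x) t - (1 / 2 : ℝ) • W t x -
      (1 / 2 : ℝ) • fderiv ℝ (W t) x x‖ ≤
      μ ^ 2 * (L₀ / d ^ 3) + (1 / 2) * (A / d) + (1 / 2) * (L₁ / d ^ 2 * ‖x‖) := by
    have ha : ‖(-t) • deriv (fun τ => W τ x) t‖ ≤ μ ^ 2 * (L₀ / d ^ 3) := by
      rw [norm_smul, Real.norm_of_nonneg (neg_nonneg.2 ht.le), ← hμ2]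
      exact mul_le_mul_of_nonneg_left h2 (by positivity)
    have hb : ‖(1 / 2 : ℝ) • W t x‖ ≤ (1 / 2) * (A / d) := by
      rw [norm_smul, Real.norm_of_nonneg (by norm_num : (0 : ℝ) ≤ 1 / 2)]
      exact mul_le_mul_of_nonneg_left h0 (by norm_num)
    have hc : ‖(1 / 2 : ℝ) • fderiv ℝ (W t) x x‖ ≤ (1 / 2) * (L₁ / d ^ 2 * ‖x‖) := by
      rw [norm_smul, Real.norm_of_nonneg (by norm_num : (0 : ℝ) ≤ 1 / 2)]
      exact mul_le_mul_of_nonneg_left hxdx (by norm_num)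
    calc ‖(-t) • deriv (fun τ => W τ x) t - (1 / 2 : ℝ) • W t x - (1 / 2 : ℝ) • fderiv ℝ (W t) x x‖
        ≤ ‖(-t) • deriv (fun τ => W τ x) t - (1 / 2 : ℝ) • W t x‖ +
            ‖(1 / 2 : ℝ) • fderiv ℝ (W t) x x‖ := norm_sub_le _ _
      _ ≤ (‖(-t) • deriv (fun τ => W τ x) t‖ + ‖(1 / 2 : ℝ) • W t x‖) +
            ‖(1 / 2 : ℝ) • fderiv ℝ (W t) x x‖ := by gcongr; exact norm_sub_le _ _
      _ ≤ μ ^ 2 * (L₀ / d ^ 3) + (1 / 2) * (A / d) + (1 / 2) * (L₁ / d ^ 2 * ‖x‖) := by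
            gcongr
  -- each term is `≤ const/d`
  have e1 : μ ^ 2 * (L₀ / d ^ 3) ≤ L₀ / d := by
    rw [show μ ^ 2 * (L₀ / d ^ 3) = L₀ / d * (μ / d) ^ 2 by field_simp]
    have hq : (μ / d) ^ 2 ≤ 1 := by
      have hq1 : μ / d ≤ 1 := (div_le_one hdpos).2 hμd
      have hq0 : 0 ≤ μ / d := div_nonneg hμpos.le hdpos.le
      exact pow_le_one₀ hq0 hq1
    calc L₀ / d * (μ / d) ^ 2 ≤ L₀ / d * 1 :=
          mul_le_mul_of_nonneg_left hq (div_nonneg hL₀nn hdpos.le)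
      _ = L₀ / d := mul_one _
  have e3 : L₁ / d ^ 2 * ‖x‖ ≤ L₁ / d := by
    rw [show L₁ / d ^ 2 * ‖x‖ = L₁ / d * (‖x‖ / d) by field_simp]
    have hq1 : ‖x‖ / d ≤ 1 := (div_le_one hdpos).2 hxd
    calc L₁ / d * (‖x‖ / d) ≤ L₁ / d * 1 :=
          mul_le_mul_of_nonneg_left hq1 (div_nonneg hL₁nn hdpos.le)
      _ = L₁ / d := mul_one _
  rw [norm_smul, Real.norm_of_nonneg hμpos.le]
  calc μ * ‖(-t) • deriv (fun τ => W τ x) t - (1 / 2 : ℝ) • W t x - (1 / 2 : ℝ) • fderiv ℝ (W t) x x‖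
      ≤ μ * (μ ^ 2 * (L₀ / d ^ 3) + (1 / 2) * (A / d) + (1 / 2) * (L₁ / d ^ 2 * ‖x‖)) :=
        mul_le_mul_of_nonneg_left hsum hμpos.le
    _ ≤ μ * (L₀ / d + (1 / 2) * (A / d) + (1 / 2) * (L₁ / d)) := by
        gcongr
    _ = (L₀ + (A + L₁) / 2) * (μ / d) := by
        field_simp
        ring

/-- **The flicker of the critical element is confined to the parabolic core.** If `K_c` is minimal
for `C`, every singular member `W` of `𝒟_{C,K_c}` admits `c ≥ 0` with
`‖√(−t)((−t)∂ₜW − ½W − ½(x·∇)W)(t,x)‖ ≤ c √(−t)/(‖x‖ + √(−t))` for all `t < 0`, `x` (envelope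
`…Envelope.envelope_of_minimal` + package `…EnvelopePackage.scaleInvariantBounds_of_minimal` +
`unsteadiness_le_of_package`). With the floors of `…CalmSliceLocalLeaf` / `…CalmSliceMean`: dense
flicker of size `δ(ρ,r)` inside the similarity region, `O(1/‖y‖)` outside. [cite: ChaeWolf2017, Thm. 1.1 (arXiv:1610.09464 p. 3)] -/
theorem flickerEnvelope_of_minimal {C Kc : ℝ}
    (hmin : ∀ K' : ℝ, K' < Kc → ∀ w : ℝ → EuclideanSpace ℝ (Fin 3) → EuclideanSpace ℝ (Fin 3),
      IsTypeIAncientMild C w →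
      (∀ s : ℝ, s < 0 → ∫⁻ x, ‖fderiv ℝ (w s) x‖ₑ ^ 2 ≤ ENNReal.ofReal (K' / Real.sqrt (-s))) →
      ¬ (∀ r > 0, ∀ M : ℝ, ∃ t ∈ Ioo (-(r ^ 2)) (0 : ℝ),
        ∃ x ∈ ball (0 : EuclideanSpace ℝ (Fin 3)) r, M < ‖w t x‖))
    {W : ℝ → EuclideanSpace ℝ (Fin 3) → EuclideanSpace ℝ (Fin 3)} (hW : IsTypeIAncientMild C W)
    (hlaw : ∀ s : ℝ, s < 0 → ∫⁻ x, ‖fderiv ℝ (W s) x‖ₑ ^ 2 ≤ ENNReal.ofReal (Kc / Real.sqrt (-s)))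
    (hsing : ∀ r > 0, ∀ M : ℝ, ∃ t ∈ Ioo (-(r ^ 2)) (0 : ℝ),
      ∃ x ∈ ball (0 : EuclideanSpace ℝ (Fin 3)) r, M < ‖W t x‖) :
    ∃ c : ℝ, 0 ≤ c ∧ ∀ t : ℝ, t < 0 → ∀ x : EuclideanSpace ℝ (Fin 3),
      ‖Real.sqrt (-t) • ((-t) • deriv (fun τ => W τ x) t - (1 / 2 : ℝ) • W t x -
        (1 / 2 : ℝ) • fderiv ℝ (W t) x x)‖ ≤ c * (Real.sqrt (-t) / (‖x‖ + Real.sqrt (-t))) := by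
  obtain ⟨A, -, henv⟩ := Envelope.envelope_of_minimal hmin
  obtain ⟨Q, -, hS⟩ := Envelope.scaleInvariantBounds_of_minimal hmin hW hlaw hsing
  exact unsteadiness_le_of_package hW (henv W hW hlaw hsing) hS

end Summit.NavierStokesRegularity.NavierStokesRegularity.Theorems.FiniteDissipationLiouville.CalmSliceLocal

end
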